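import Literature.NumberTheory.LFunctions.ChebyshevBiasMeanValueCesaro
import Literature.NumberTheory.LFunctions.ChebyshevBiasMeanValuePrimePowers
import Literature.NumberTheory.LFunctions.ChebyshevBiasNaturalDensity
import Literature.NumberTheory.LFunctions.WeilCriterionConverseDirichlet
import HarnessLib

/-!
# GRH-CONDITIONAL mean value PROVED (Hayani 2025, Thm 1.4; discharge of `Hayani2025_thm1_4`) — RH-FREE literature; «nothing here bears on the truth of RH»
# `(1/x) ∫₂^x (π_{1/2}(u;q,a) − π_{1/2}(u;q,b)) du = −M(q;a,b) log log x + C + O(log log x/log x)` under GRH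

LINE 1 — LABEL: GRH-CONDITIONAL (an implication FROM the GRH for the non-principal characters mod `q`), PROVED.
Third and last file of the discharge of the named fact `Literature.NumberTheory.LFunctions.Hayani2025_thm1_4`
(`ChebyshevBiasNaturalDensity.lean`), typed AS PRINTED from

> M. Hayani, *Chebyshev's bias without linear independence*, arXiv:2512.23302 (v1 2025, v3 2026), **Thm 1.4**
> [bib: `Hayani2025`; PREPRINT, unrefereed; RH literature-typing tranche 1 part 2 — a descendant of
> Suzuki, Ramanujan J. 68 (2025) = arXiv:2411.07436].

Nothing in this file is, or is worded as, progress toward RH or GRH: the theorem ASSUMES the GRH for the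
non-principal characters mod `q` and computes a Cesàro mean. No endorsement of the preprint is implied by the
formalisation; the kernel theorem stands on its own proof.

## The proof (deviation from the printed one recorded)

Printed (§3): summation by parts `π_{1/2} = π/√x + ½∫ π u^{-3/2}`, the truncated explicit formula for `ψ(x; t)`
(MV 12.12) integrated (`|∫Δ| ≪ log Y`, Lemma 2.3 (1)), and `∫ e^y log y = e^Y log Y + O(e^Y/Y)`. Here, per character
`χ ≠ χ₀` (then orthogonality):

1. `ChebyshevBiasMeanValueCesaro.lean`: `(1/x)Σ_{n ≤ x}(a_n/log n)(x − n) = f_χ(x)/log x + ∫₂^x f_χ φ_x` for the tree's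
   smoothed sum `f_χ(v) = Σ_{n ≤ v} Λ(n)χ(n)n^{-1/2} log(v/n)`, whose GRH expansion `−(m_χ/2)log²v − c₀ log v + O(1)`
   (Suzuki (4.5)/(4.5'), tree; all `χ ≠ χ₀` by `exists_norm_halfLineSum_add_le_of_GRH_all`) gives the Cesàro mean of
   `Σ_{p^k ≤ u} χ(p)^k/(k p^{k/2})` as `−m_χ log log x + C + O(1/log x)` (`cesaro_of_rieszBound`);
2. `ChebyshevBiasMeanValuePrimePowers.lean`: the prime squares contribute `½[χ² = χ₀] log log x + C' + O(1/log x)`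
   (Mertens II for `χ²`: Hardy–Wright Thm 427 for `χ₀`, Abel summation from the tree's GRH bound MV Thm 13.7 otherwise)
   and the `k ≥ 3` powers a constant `+ O(1/log x)`; hence (`primePart_cesaro`)
   `(1/x)Σ_{p ≤ x} χ(p)p^{-1/2}(x − p) = −(m_χ + δ_χ) log log x + C_χ + O(1/log x)`;
3. this file: `π_{1/2}(x;q,a) − π_{1/2}(x;q,b) = φ(q)⁻¹ Σ_{χ ≠ χ₀} (χ̄(a) − χ̄(b)) Σ_{p ≤ x} χ(p)/√p` (Mathlib's
   `DirichletCharacter.sum_char_inv_mul_char_eq`), `∫₂^x = Σ_{n ≤ x}(·)(x − n)` (`integral_stepSum`), and the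
   coefficient identity `φ(q)⁻¹ Σ_{χ ≠ χ₀}(χ̄(a) − χ̄(b))(m_χ + δ_χ) = M(q;a,b)` (`biasMean_eq_sum`: `Σ_{χ²=χ₀} χ(a) = r(a)`
   by orthogonality, `m_{χ̄} = m_χ` by `WeilConverseChar.zeroOrder_inv_conj`). The error obtained is `O(1/log x)`,
   which is `O(log log x/log x)`.

## What is here (all PROVED, axioms standard)
* `Hayani2025Mean.primePart_cesaro`, `Hayani2025Mean.classCoeff_eq_sum` (orthogonality),
  `Hayani2025Mean.integral_primeSumHalf_sub`, `Hayani2025Mean.sum_sq_eq_one_apply_eq_sqrtCount` (`Σ_{χ²=χ₀}χ(a) = r(a)`),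
  `Hayani2025Mean.biasMean_eq_sum`;
* **`Hayani2025_thm1_4_holds : Hayani2025_thm1_4`** (net literature debt −1).

## References
* [Hayani2025] M. Hayani, arXiv:2512.23302, Thm 1.4, §§2–3.
* [Suzuki2025Chebyshev] M. Suzuki, Ramanujan J. 68 (2025) 95 = arXiv:2411.07436, §4.1.
* [MontgomeryVaughan2007] H. L. Montgomery, R. C. Vaughan, *Multiplicative Number Theory I*, Cor. 10.8, Thm 13.7, §5.1.
-/

noncomputable section

open Real Filter Finset ArithmeticFunction MeasureTheory

namespace Literature.NumberTheory.LFunctions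

namespace Hayani2025Mean

variable {q : ℕ} (χ : DirichletCharacter ℂ q)

/-! ## §1 Per-character Cesàro asymptotic of the prime part -/

section Assembly

variable [NeZero q]

omit [NeZero q] in
/-- `a_χ(1) = 0` (`Λ(1) = 0`). [folklore] -/
private theorem halfCoeff_one : halfCoeff χ 1 = 0 := by
  simp [halfCoeff]

omit [NeZero q] in
/-- The Riesz sum of `a_χ` is the tree's `f_χ = halfLineSum χ`. [folklore] -/
private theorem rieszSum_halfCoeff (v : ℝ) : rieszSum (halfCoeff χ) v = HalfLineRiesz.halfLineSum χ v := rfl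

/-- **The prime part, per character** (GRH for `χ`, and for `χ²` if `χ² ≠ χ₀`): for some `C`, `K`, `x₀`,
`‖(1/x) Σ_{n ≤ x} [n prime] χ(n) n^{-1/2} (x − n) + (m_χ + δ_χ) log log x − C‖ ≤ K/log x` for `x ≥ x₀`.
[cite: Hayani2025, Thm 1.4 (proof, §3)] -/
theorem primePart_cesaro (hχ : χ ≠ 1) (hGRH : χ.RiemannHypothesis)
    (hGRH2 : χ ^ 2 ≠ 1 → (χ ^ 2).RiemannHypothesis) :
    ∃ C : ℂ, ∃ K x₀ : ℝ, 2 ≤ x₀ ∧ ∀ x : ℝ, x₀ ≤ x →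
      ‖(∑ n ∈ Finset.Icc 1 ⌊x⌋₊, primeCoeff χ n * ((x - n : ℝ) : ℂ)) / x +
        ((DirichletDisc.zeroOrder χ (1 / 2) : ℂ) + halfDelta χ) * (Real.log (Real.log x) : ℂ) - C‖ ≤
        K / Real.log x := by
  obtain ⟨c₀, B, hB⟩ := exists_norm_halfLineSum_add_le_of_GRH_all χ hχ hGRH
  obtain ⟨CQ, KQ, hQ⟩ := cesaro_of_rieszBound (halfCoeff χ) (halfCoeff_one χ)
    (m := (DirichletDisc.zeroOrder χ (1 / 2) : ℂ)) (c₀ := c₀) (B := B)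
    (fun v hv ↦ by rw [rieszSum_halfCoeff]; exact hB v hv)
  obtain ⟨β, K₂, u₂, hu₂, h2⟩ := sqPart_pointwise χ hGRH2
  obtain ⟨K₂', h2'⟩ := cesaro_of_pointwise (sqCoeff χ) (α := halfDelta χ) (β := β) (K := K₂) hu₂
    (fun u hu ↦ h2 u hu)
  obtain ⟨K₃, h3⟩ := highPart_pointwise χ
  obtain ⟨K₃', h3'⟩ := cesaro_of_pointwise (highCoeff χ) (α := 0) (β := highConst χ) (K := K₃) (u₀ := 3)
    (by norm_num) (fun u hu ↦ by rw [zero_mul, sub_zero]; exact h3 u hu)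
  refine ⟨CQ - β - highConst χ, KQ + K₂' + K₃', max u₂ 3, le_max_of_le_left hu₂, fun x hx ↦ ?_⟩
  have hx2 : u₂ ≤ x := le_trans (le_max_left _ _) hx
  have hx3 : 3 ≤ x := le_trans (le_max_right _ _) hx
  have hx2' : 2 ≤ x := by linarith
  have hQx := hQ x hx2'
  have h2x := h2' x hx2
  have h3x := h3' x hx3
  -- `Σ primeCoeff (x−n) = Σ qCoeff (x−n) − Σ sqCoeff (x−n) − Σ highCoeff (x−n)`
  have hsplit : ∑ n ∈ Finset.Icc 1 ⌊x⌋₊, primeCoeff χ n * ((x - n : ℝ) : ℂ) =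
      cesaroNum (halfCoeff χ) x - ∑ n ∈ Finset.Icc 1 ⌊x⌋₊, sqCoeff χ n * ((x - n : ℝ) : ℂ) -
        ∑ n ∈ Finset.Icc 1 ⌊x⌋₊, highCoeff χ n * ((x - n : ℝ) : ℂ) := by
    rw [cesaroNum, eq_sub_iff_add_eq, eq_sub_iff_add_eq, ← Finset.sum_add_distrib, ← Finset.sum_add_distrib]
    refine Finset.sum_congr rfl fun n _ ↦ ?_
    have h := qCoeff_eq_add χ n
    rw [qCoeff] at h
    rw [h]
    ring
  have hid : (∑ n ∈ Finset.Icc 1 ⌊x⌋₊, primeCoeff χ n * ((x - n : ℝ) : ℂ)) / x +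
      ((DirichletDisc.zeroOrder χ (1 / 2) : ℂ) + halfDelta χ) * (Real.log (Real.log x) : ℂ) -
        (CQ - β - highConst χ) =
      (cesaroNum (halfCoeff χ) x / x + (DirichletDisc.zeroOrder χ (1 / 2) : ℂ) * (Real.log (Real.log x) : ℂ) - CQ) -
      ((∑ n ∈ Finset.Icc 1 ⌊x⌋₊, sqCoeff χ n * ((x - n : ℝ) : ℂ)) / x -
        halfDelta χ * (Real.log (Real.log x) : ℂ) - β) -
      ((∑ n ∈ Finset.Icc 1 ⌊x⌋₊, highCoeff χ n * ((x - n : ℝ) : ℂ)) / x -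
        0 * (Real.log (Real.log x) : ℂ) - highConst χ) := by
    rw [hsplit]
    ring
  rw [hid]
  calc _ ≤ ‖cesaroNum (halfCoeff χ) x / x + (DirichletDisc.zeroOrder χ (1 / 2) : ℂ) * (Real.log (Real.log x) : ℂ) - CQ‖ +
        ‖(∑ n ∈ Finset.Icc 1 ⌊x⌋₊, sqCoeff χ n * ((x - n : ℝ) : ℂ)) / x -
          halfDelta χ * (Real.log (Real.log x) : ℂ) - β‖ +
        ‖(∑ n ∈ Finset.Icc 1 ⌊x⌋₊, highCoeff χ n * ((x - n : ℝ) : ℂ)) / x -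
          0 * (Real.log (Real.log x) : ℂ) - highConst χ‖ := by
        refine (norm_sub_le _ _).trans ?_
        gcongr
        exact norm_sub_le _ _
    _ ≤ KQ / Real.log x + K₂' / Real.log x + K₃' / Real.log x := by gcongr
    _ = (KQ + K₂' + K₃') / Real.log x := by ring

/-! ## §2 Orthogonality: `π_{1/2}(x; q, a)` through `Σ_{p ≤ x} χ(p)/√p` -/

variable (q) in
/-- `d_a(n) = [n prime, n ≡ a (mod q)] n^{-1/2}`, the coefficients of `π_{1/2}(x; q, a)`. [folklore] -/
def classCoeff (a : ZMod q) (n : ℕ) : ℂ := if n.Prime ∧ (n : ZMod q) = a then 1 / (Real.sqrt n : ℂ) else 0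

omit [NeZero q] χ in
/-- `π_{1/2}(u; q, a) = Σ_{n ≤ u} d_a(n)` (as a complex number). [cite: Hayani2025, §1 eq. (1.1)] -/
theorem primeSumHalf_eq_stepSum (a : ZMod q) (u : ℝ) :
    ((primeSumHalf q a u : ℝ) : ℂ) = stepSum (classCoeff q a) u := by
  rw [primeSumHalf, Complex.ofReal_sum, stepSum, Finset.sum_filter]
  refine Finset.sum_congr rfl fun n _ ↦ ?_
  unfold classCoeff
  split_ifs <;> simp

omit χ in
/-- **Orthogonality**: `d_a(n) = φ(q)⁻¹ Σ_χ χ(a)⁻¹ · [n prime] χ(n) n^{-1/2}` for a unit `a`.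
[cite: Hayani2025, §2 («By linearity we have `ψ(x;t) = Σ_{χ ≠ χ₀} ⟨t,χ⟩ ψ(x;χ)`»)] -/
theorem classCoeff_eq_sum {a : ZMod q} (ha : IsUnit a) (n : ℕ) :
    classCoeff q a n = ((q.totient : ℂ))⁻¹ * ∑ χ : DirichletCharacter ℂ q, χ a⁻¹ * primeCoeff χ n := by
  have hφ : (q.totient : ℂ) ≠ 0 := by exact_mod_cast (Nat.totient_pos.2 (NeZero.pos q)).ne'
  by_cases hp : n.Prime
  · have horth := DirichletCharacter.sum_char_inv_mul_char_eq ℂ ha (n : ZMod q)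
    have hsum : ∑ χ : DirichletCharacter ℂ q, χ a⁻¹ * primeCoeff χ n =
        (∑ χ : DirichletCharacter ℂ q, χ a⁻¹ * χ (n : ZMod q)) / (Real.sqrt n : ℂ) := by
      rw [Finset.sum_div]
      refine Finset.sum_congr rfl fun χ _ ↦ ?_
      simp only [primeCoeff, hp, if_true]
      ring
    rw [hsum, horth]
    unfold classCoeff
    by_cases han : (n : ZMod q) = a
    · rw [if_pos ⟨hp, han⟩, if_pos han.symm]
      field_simp
    · rw [if_neg (fun h ↦ han h.2), if_neg (fun h ↦ han h.symm)]
      simp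
  · have h0 : ∀ χ : DirichletCharacter ℂ q, primeCoeff χ n = 0 := fun χ ↦ by simp [primeCoeff, hp]
    simp [classCoeff, hp, h0]

omit [NeZero q] χ in
/-- `∫₂^x (π_{1/2}(u;q,a) − π_{1/2}(u;q,b)) du = Σ_{n ≤ x} (d_a(n) − d_b(n))(x − n)` for `x ≥ 2`.
[cite: Hayani2025, Thm 1.4 (proof, §3: `∫₂^x π_{1/2}(u;t) du = ∫_{log 2}^{Y} e^y π_{1/2}(e^y;t) dy`)] -/
theorem integral_primeSumHalf_sub (a b : ZMod q) {x : ℝ} (hx : 2 ≤ x) :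
    ((∫ u in (2 : ℝ)..x, (primeSumHalf q a u - primeSumHalf q b u) : ℝ) : ℂ) =
      ∑ n ∈ Finset.Icc 1 ⌊x⌋₊, (classCoeff q a n - classCoeff q b n) * ((x - n : ℝ) : ℂ) := by
  set d : ℕ → ℂ := fun n ↦ classCoeff q a n - classCoeff q b n with hd
  have hrepr : ∀ u : ℝ, ((primeSumHalf q a u - primeSumHalf q b u : ℝ) : ℂ) = stepSum d u := by
    intro u
    push_cast
    rw [primeSumHalf_eq_stepSum, primeSumHalf_eq_stepSum, stepSum, stepSum, stepSum, ← Finset.sum_sub_distrib]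
  rw [← intervalIntegral.integral_ofReal, intervalIntegral.integral_congr fun u _ ↦ hrepr u]
  have h12 := intervalIntegral.integral_add_adjacent_intervals (intervalIntegrable_stepSum d 1 2)
    (intervalIntegrable_stepSum d 2 x)
  rw [integral_stepSum d (by linarith : (1 : ℝ) ≤ x), integral_stepSum d (by norm_num : (1 : ℝ) ≤ 2)] at h12
  have hd1 : d 1 = 0 := by simp [hd, classCoeff, Nat.not_prime_one]
  have h2zero : ∑ n ∈ Finset.Icc 1 ⌊(2 : ℝ)⌋₊, d n * (((2 : ℝ) - n : ℝ) : ℂ) = 0 := by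
    have h2 : ⌊(2 : ℝ)⌋₊ = 2 := by norm_num
    rw [h2, Finset.sum_Icc_succ_top (by norm_num), Finset.Icc_self, Finset.sum_singleton, hd1]
    push_cast
    ring
  rw [h2zero, zero_add] at h12
  exact h12

/-! ## §3 Character-sum identities: `Σ_{χ² = χ₀} χ(a) = r(a)` and `m_{χ̄} = m_χ` -/

omit [NeZero q] χ in
/-- For a real character (`χ² = χ₀`) and a unit `a`: `χ(a⁻¹) = χ(a)`. [folklore] -/
private theorem apply_inv_of_sq_eq_one {ψ : DirichletCharacter ℂ q} (hψ : ψ ^ 2 = 1) {a : ZMod q} (ha : IsUnit a) :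
    ψ a⁻¹ = ψ a := by
  have h1 : ψ a * ψ a⁻¹ = 1 := by rw [← map_mul, ZMod.mul_inv_of_unit a ha, map_one]
  have h2 : ψ a * ψ a = 1 := by rw [← pow_two, ← MulChar.pow_apply' ψ two_ne_zero, hψ, MulChar.one_apply ha]
  have h0 : ψ a ≠ 0 := fun h ↦ by rw [h, zero_mul] at h2; exact zero_ne_one h2
  exact mul_left_cancel₀ h0 (h1.trans h2.symm)

omit χ in
/-- **`Σ_{χ² = χ₀} χ(a) = r(a) = #{x : x² = a}`** for a unit `a` (duality for the quotient by squares).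
[cite: Hayani2025, §1 (definition of `r(a)` and `M(q;a,b)`)] -/
theorem sum_sq_eq_one_apply_eq_sqrtCount {a : ZMod q} (ha : IsUnit a) :
    ∑ χ ∈ (Finset.univ : Finset (DirichletCharacter ℂ q)).filter (fun χ ↦ χ ^ 2 = 1), χ a =
      (sqrtCount q a : ℂ) := by
  classical
  have hφ : (q.totient : ℂ) ≠ 0 := by exact_mod_cast (Nat.totient_pos.2 (NeZero.pos q)).ne'
  -- `φ(q) · r(a) = Σ_x Σ_χ χ(a⁻¹) χ(x²) = Σ_χ χ(a⁻¹) Σ_x χ²(x) = φ(q) Σ_{χ²=1} χ(a⁻¹)`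
  have hcount : (sqrtCount q a : ℂ) = ∑ x : ZMod q, if a = x ^ 2 then (1 : ℂ) else 0 := by
    rw [sqrtCount, Finset.sum_boole]
    congr 2
    ext x
    simp only [Finset.mem_filter, Finset.mem_univ, true_and]
    exact eq_comm
  have horth : ∀ x : ZMod q, (q.totient : ℂ) * (if a = x ^ 2 then (1 : ℂ) else 0) =
      ∑ χ : DirichletCharacter ℂ q, χ a⁻¹ * (χ ^ 2) x := by
    intro x
    rw [mul_ite, mul_one, mul_zero, ← DirichletCharacter.sum_char_inv_mul_char_eq ℂ ha (x ^ 2)]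
    refine Finset.sum_congr rfl fun χ _ ↦ ?_
    rw [MulChar.pow_apply' χ two_ne_zero, map_pow]
  have hinner : ∀ χ : DirichletCharacter ℂ q, ∑ x : ZMod q, (χ ^ 2) x = if χ ^ 2 = 1 then (q.totient : ℂ) else 0 := by
    intro χ
    split_ifs with h
    · rw [h, MulChar.sum_one_eq_card_units, ZMod.card_units_eq_totient]
    · exact MulChar.sum_eq_zero_of_ne_one h
  have key : (q.totient : ℂ) * (sqrtCount q a : ℂ) =
      (q.totient : ℂ) * ∑ χ ∈ (Finset.univ : Finset (DirichletCharacter ℂ q)).filter (fun χ ↦ χ ^ 2 = 1), χ a := by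
    rw [hcount, Finset.mul_sum]
    simp_rw [horth]
    rw [Finset.sum_comm]
    simp_rw [← Finset.mul_sum, hinner]
    rw [Finset.sum_filter, Finset.mul_sum]
    refine Finset.sum_congr rfl fun χ _ ↦ ?_
    split_ifs with h
    · rw [apply_inv_of_sq_eq_one h ha]; ring
    · simp
  exact (mul_left_cancel₀ hφ key).symm

/-- `m_{χ⁻¹} = m_χ` at `s = ½` (reflection `L(s, χ̄) = conj L(s̄, χ)`, the tree's `WeilConverseChar.zeroOrder_inv_conj`).
[cite: MontgomeryVaughan2007, Corollary 10.8] -/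
theorem zeroOrder_inv_half (hχ : χ ≠ 1) :
    DirichletDisc.zeroOrder χ⁻¹ (1 / 2) = DirichletDisc.zeroOrder χ (1 / 2) := by
  have h := WeilConverseChar.zeroOrder_inv_conj hχ (1 / 2)
  have hc : (starRingEnd ℂ) (1 / 2 : ℂ) = 1 / 2 := by rw [map_div₀, map_one, map_ofNat]
  rwa [hc] at h

omit χ in
/-- **The bias constant through characters**: for units `a`, `b`,
`M(q;a,b) = φ(q)⁻¹ Σ_{χ ≠ χ₀} (χ(a)⁻¹ − χ(b)⁻¹)(m_χ + δ_χ)` (`δ_χ = ½[χ² = χ₀]`).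
[cite: Hayani2025, §1 (definition of `M(q;a,b)`) and §2 (definition of `M(t)`)] -/
theorem biasMean_eq_sum {a b : ZMod q} (ha : IsUnit a) (hb : IsUnit b) :
    biasMean q a b = ((q.totient : ℂ))⁻¹ *
      ∑ χ ∈ (Finset.univ : Finset (DirichletCharacter ℂ q)).erase 1,
        (χ a⁻¹ - χ b⁻¹) * ((DirichletDisc.zeroOrder χ (1 / 2) : ℂ) + halfDelta χ) := by
  classical
  set S := (Finset.univ : Finset (DirichletCharacter ℂ q)).erase 1 with hS
  have hφ : (q.totient : ℂ) ≠ 0 := by exact_mod_cast (Nat.totient_pos.2 (NeZero.pos q)).ne'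
  -- (E1) the `m_χ` part: reindex by `χ ↦ χ⁻¹`
  have hE1 : ∑ χ ∈ S, (χ a⁻¹ - χ b⁻¹) * (DirichletDisc.zeroOrder χ (1 / 2) : ℂ) =
      ∑ χ ∈ S, (χ a - χ b) * (DirichletDisc.zeroOrder χ (1 / 2) : ℂ) := by
    refine Finset.sum_nbij' (fun χ ↦ χ⁻¹) (fun χ ↦ χ⁻¹) ?_ ?_ (fun χ _ ↦ inv_inv χ) (fun χ _ ↦ inv_inv χ) ?_
    · intro χ hχ
      rw [hS, Finset.mem_erase] at hχ ⊢
      exact ⟨inv_ne_one.2 hχ.1, Finset.mem_univ _⟩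
    · intro χ hχ
      rw [hS, Finset.mem_erase] at hχ ⊢
      exact ⟨inv_ne_one.2 hχ.1, Finset.mem_univ _⟩
    · intro χ hχ
      rw [hS, Finset.mem_erase] at hχ
      have hne : χ ≠ 1 := hχ.1
      have hinva : χ⁻¹ a = χ a⁻¹ := by
        rw [MulChar.inv_apply_eq_inv']
        have h1 : χ a * χ a⁻¹ = 1 := by rw [← map_mul, ZMod.mul_inv_of_unit a ha, map_one]
        exact (eq_inv_of_mul_eq_one_right h1).symm
      have hinvb : χ⁻¹ b = χ b⁻¹ := by
        rw [MulChar.inv_apply_eq_inv']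
        have h1 : χ b * χ b⁻¹ = 1 := by rw [← map_mul, ZMod.mul_inv_of_unit b hb, map_one]
        exact (eq_inv_of_mul_eq_one_right h1).symm
      rw [hinva, hinvb, zeroOrder_inv_half χ hne]
  -- (E2) the `δ_χ` part
  have hE2 : ∑ χ ∈ S, (χ a⁻¹ - χ b⁻¹) * halfDelta χ = (1 / 2 : ℂ) * ((sqrtCount q a : ℂ) - sqrtCount q b) := by
    have h1 : ∑ χ ∈ S, (χ a⁻¹ - χ b⁻¹) * halfDelta χ =
        ∑ χ ∈ (Finset.univ : Finset (DirichletCharacter ℂ q)), (χ a⁻¹ - χ b⁻¹) * halfDelta χ := by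
      rw [hS]
      refine Finset.sum_erase _ ?_
      have hau : IsUnit a⁻¹ := IsUnit.of_mul_eq_one _ (ZMod.inv_mul_of_unit a ha)
      have hbu : IsUnit b⁻¹ := IsUnit.of_mul_eq_one _ (ZMod.inv_mul_of_unit b hb)
      rw [MulChar.one_apply hau, MulChar.one_apply hbu, sub_self, zero_mul]
    rw [h1, ← sum_sq_eq_one_apply_eq_sqrtCount ha, ← sum_sq_eq_one_apply_eq_sqrtCount hb, Finset.sum_filter,
      Finset.sum_filter, ← Finset.sum_sub_distrib, Finset.mul_sum]
    refine Finset.sum_congr rfl fun χ _ ↦ ?_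
    unfold halfDelta
    split_ifs with h
    · rw [apply_inv_of_sq_eq_one h ha, apply_inv_of_sq_eq_one h hb]; ring
    · simp
  rw [Finset.sum_congr rfl fun χ _ ↦ mul_add _ _ _, Finset.sum_add_distrib, hE1, hE2, biasMean, ← hS]
  field_simp
  ring

/-! ## §4 The discharge -/

end Assembly

end Hayani2025Mean

open Hayani2025Mean in
/-- **Hayani 2025, Thm 1.4, PROVED (discharge of the named fact `Hayani2025_thm1_4`).** «Let `q ≥ 3` and assume GRH
for all non-principal Dirichlet characters modulo `q`. Let `a, b` be distinct invertible residue classes modulo `q`.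
Then `(1/x) ∫₂^x (π_{1/2}(u;q,a) − π_{1/2}(u;q,b)) du = −M(q;a,b) log log x + C + O(log log x/log x)`.» Proved with
the error `O(1/log x)` through the tree's smoothed half-line explicit formula under GRH (Suzuki (4.5)/(4.5')) and
the Cesàro identity of `ChebyshevBiasMeanValueCesaro.lean`, Mertens II for `χ²`, and orthogonality.
GRH-CONDITIONAL; nothing here bears on the truth of RH. [cite: Hayani2025, Thm 1.4] -/
theorem Hayani2025_thm1_4_holds : Hayani2025_thm1_4 := by
  intro q _ hq hGRH a b ha hb hab
  classical
  -- per-character data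
  have key : ∀ χ : DirichletCharacter ℂ q, ∃ C : ℂ, ∃ K x₀ : ℝ, 2 ≤ x₀ ∧ (χ ≠ 1 → ∀ x : ℝ, x₀ ≤ x →
      ‖(∑ n ∈ Finset.Icc 1 ⌊x⌋₊, primeCoeff χ n * ((x - n : ℝ) : ℂ)) / x +
        ((DirichletDisc.zeroOrder χ (1 / 2) : ℂ) + halfDelta χ) * (Real.log (Real.log x) : ℂ) - C‖ ≤
        K / Real.log x) := by
    intro χ
    by_cases hχ : χ = 1
    · exact ⟨0, 0, 2, le_rfl, fun h ↦ absurd hχ h⟩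
    · obtain ⟨C, K, x₀, hx₀, h⟩ := primePart_cesaro χ hχ (hGRH χ hχ) (fun h2 ↦ hGRH _ h2)
      exact ⟨C, K, x₀, hx₀, fun _ ↦ h⟩
  choose Cf Kf xf hxf hmain using key
  set S := (Finset.univ : Finset (DirichletCharacter ℂ q)).erase 1 with hS
  set coef : DirichletCharacter ℂ q → ℂ := fun χ ↦ χ a⁻¹ - χ b⁻¹ with hcoef
  set X₀ : ℝ := Real.exp (Real.exp 1) + ∑ χ, xf χ with hX₀
  set Ktot : ℝ := ‖((q.totient : ℂ))⁻¹‖ * ∑ χ ∈ S, ‖coef χ‖ * |Kf χ| with hKtot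
  refine ⟨((q.totient : ℂ))⁻¹ * ∑ χ ∈ S, coef χ * Cf χ, ?_⟩
  have hφ : (q.totient : ℂ) ≠ 0 := by exact_mod_cast (Nat.totient_pos.2 (NeZero.pos q)).ne'
  -- the explicit bound for `x ≥ X₀`
  have hX₀χ : ∀ χ, xf χ ≤ X₀ := fun χ ↦ by
    have h1 : xf χ ≤ ∑ χ, xf χ := Finset.single_le_sum (fun χ _ ↦ by linarith [hxf χ]) (Finset.mem_univ χ)
    have h2 : 0 < Real.exp (Real.exp 1) := Real.exp_pos _
    linarith
  have hX₀e : Real.exp (Real.exp 1) ≤ X₀ := by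
    have : 0 ≤ ∑ χ, xf χ := Finset.sum_nonneg fun χ _ ↦ by linarith [hxf χ]
    linarith
  have hbound : ∀ x : ℝ, X₀ ≤ x →
      ‖(((1 / x * ∫ u in (2 : ℝ)..x, (primeSumHalf q a u - primeSumHalf q b u) : ℝ) : ℂ) +
          biasMean q a b * (Real.log (Real.log x) : ℂ) - ((q.totient : ℂ))⁻¹ * ∑ χ ∈ S, coef χ * Cf χ)‖ ≤
        Ktot / Real.log x := by
    intro x hx
    have hxe : Real.exp (Real.exp 1) ≤ x := hX₀e.trans hx
    have hx2 : 2 ≤ x := by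
      have : (2 : ℝ) ≤ Real.exp (Real.exp 1) := by
        have h1 : (1 : ℝ) ≤ Real.exp 1 := by linarith [Real.add_one_le_exp (1 : ℝ)]
        linarith [Real.add_one_le_exp (Real.exp 1)]
      linarith
    have hx0 : 0 < x := by linarith
    have hlogx : 0 < Real.log x := Real.log_pos (by linarith)
    -- the integral as a character sum
    have hint : (((1 / x * ∫ u in (2 : ℝ)..x, (primeSumHalf q a u - primeSumHalf q b u) : ℝ) : ℂ)) =
        ((q.totient : ℂ))⁻¹ * ∑ χ ∈ S, coef χ *
          ((∑ n ∈ Finset.Icc 1 ⌊x⌋₊, primeCoeff χ n * ((x - n : ℝ) : ℂ)) / x) := by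
      push_cast
      rw [integral_primeSumHalf_sub a b hx2]
      have hd : ∀ n, classCoeff q a n - classCoeff q b n =
          ((q.totient : ℂ))⁻¹ * ∑ χ : DirichletCharacter ℂ q, coef χ * primeCoeff χ n := by
        intro n
        rw [classCoeff_eq_sum ha, classCoeff_eq_sum hb, ← mul_sub, ← Finset.sum_sub_distrib]
        congr 1
        refine Finset.sum_congr rfl fun χ _ ↦ ?_
        simp only [hcoef]
        ring
      simp_rw [hd]
      -- drop `χ = 1` (its coefficient vanishes) and swap the sums
      have hcoef1 : coef 1 = 0 := by
        have hau : IsUnit a⁻¹ := IsUnit.of_mul_eq_one _ (ZMod.inv_mul_of_unit a ha)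
        have hbu : IsUnit b⁻¹ := IsUnit.of_mul_eq_one _ (ZMod.inv_mul_of_unit b hb)
        simp only [hcoef, MulChar.one_apply hau, MulChar.one_apply hbu, sub_self]
      have hS' : ∀ n, ∑ χ : DirichletCharacter ℂ q, coef χ * primeCoeff χ n = ∑ χ ∈ S, coef χ * primeCoeff χ n := by
        intro n
        rw [hS, Finset.sum_erase]
        rw [hcoef1, zero_mul]
      simp_rw [hS']
      simp only [Finset.mul_sum, Finset.sum_mul, Finset.sum_div]
      rw [Finset.sum_comm]
      refine Finset.sum_congr rfl fun χ _ ↦ Finset.sum_congr rfl fun n _ ↦ ?_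
      push_cast
      ring
    rw [hint, biasMean_eq_sum ha hb, ← hS]
    have hcomb : ((q.totient : ℂ))⁻¹ * ∑ χ ∈ S, coef χ *
          ((∑ n ∈ Finset.Icc 1 ⌊x⌋₊, primeCoeff χ n * ((x - n : ℝ) : ℂ)) / x) +
        ((q.totient : ℂ))⁻¹ * (∑ χ ∈ S, (χ a⁻¹ - χ b⁻¹) *
          ((DirichletDisc.zeroOrder χ (1 / 2) : ℂ) + halfDelta χ)) * (Real.log (Real.log x) : ℂ) -
        ((q.totient : ℂ))⁻¹ * ∑ χ ∈ S, coef χ * Cf χ =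
        ((q.totient : ℂ))⁻¹ * ∑ χ ∈ S, coef χ *
          ((∑ n ∈ Finset.Icc 1 ⌊x⌋₊, primeCoeff χ n * ((x - n : ℝ) : ℂ)) / x +
            ((DirichletDisc.zeroOrder χ (1 / 2) : ℂ) + halfDelta χ) * (Real.log (Real.log x) : ℂ) - Cf χ) := by
      symm
      have hterm : ∀ χ ∈ S, coef χ *
          ((∑ n ∈ Finset.Icc 1 ⌊x⌋₊, primeCoeff χ n * ((x - n : ℝ) : ℂ)) / x +
            ((DirichletDisc.zeroOrder χ (1 / 2) : ℂ) + halfDelta χ) * (Real.log (Real.log x) : ℂ) - Cf χ) =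
          coef χ * ((∑ n ∈ Finset.Icc 1 ⌊x⌋₊, primeCoeff χ n * ((x - n : ℝ) : ℂ)) / x) +
          (χ a⁻¹ - χ b⁻¹) * ((DirichletDisc.zeroOrder χ (1 / 2) : ℂ) + halfDelta χ) *
            (Real.log (Real.log x) : ℂ) - coef χ * Cf χ := by
        intro χ _
        simp only [hcoef]
        ring
      rw [Finset.sum_congr rfl hterm, Finset.sum_sub_distrib, Finset.sum_add_distrib, ← Finset.sum_mul]
      ring
    rw [hcomb, norm_mul, hKtot]
    have hT : ‖∑ χ ∈ S, coef χ *
        ((∑ n ∈ Finset.Icc 1 ⌊x⌋₊, primeCoeff χ n * ((x - n : ℝ) : ℂ)) / x +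
          ((DirichletDisc.zeroOrder χ (1 / 2) : ℂ) + halfDelta χ) * (Real.log (Real.log x) : ℂ) - Cf χ)‖ ≤
        (∑ χ ∈ S, ‖coef χ‖ * |Kf χ|) / Real.log x := by
      rw [Finset.sum_div]
      refine (norm_sum_le _ _).trans (Finset.sum_le_sum fun χ hχ ↦ ?_)
      have hχ1 : χ ≠ 1 := (Finset.mem_erase.1 hχ).1
      rw [norm_mul, mul_div_assoc]
      refine mul_le_mul_of_nonneg_left ?_ (norm_nonneg _)
      exact (hmain χ hχ1 x ((hX₀χ χ).trans hx)).trans (div_le_div_of_nonneg_right (le_abs_self _) hlogx.le)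
    calc _ ≤ ‖((q.totient : ℂ))⁻¹‖ * ((∑ χ ∈ S, ‖coef χ‖ * |Kf χ|) / Real.log x) :=
          mul_le_mul_of_nonneg_left hT (norm_nonneg _)
      _ = _ := by ring
  -- `K/log x ≤ K · (log log x/log x)` once `log log x ≥ 1`
  refine Asymptotics.IsBigO.of_bound Ktot ?_
  filter_upwards [Filter.eventually_ge_atTop X₀] with x hx
  have hxe : Real.exp (Real.exp 1) ≤ x := hX₀e.trans hx
  have hx1 : 1 < x := lt_of_lt_of_le (by linarith [Real.add_one_le_exp (Real.exp 1), Real.exp_pos 1]) hxe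
  have hlogx : Real.exp 1 ≤ Real.log x := by
    rw [← Real.log_exp (Real.exp 1)]
    exact Real.log_le_log (Real.exp_pos _) hxe
  have hlogx0 : 0 < Real.log x := lt_of_lt_of_le (Real.exp_pos 1) hlogx
  have hll : 1 ≤ Real.log (Real.log x) := by
    rw [← Real.log_exp 1]
    exact Real.log_le_log (Real.exp_pos 1) hlogx
  have hKtot0 : 0 ≤ Ktot := by positivity
  refine (hbound x hx).trans ?_
  rw [Real.norm_of_nonneg (div_nonneg (by linarith) hlogx0.le), ← mul_div_assoc]
  exact div_le_div_of_nonneg_right (by nlinarith) hlogx0.le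

end Literature.NumberTheory.LFunctions

end
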